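import Mathlib
import Literature.Geometry.Riemannian.SphericalCylinderEntropy
import Literature.MeasureTheory.Hausdorff.SphereRotationInvariance
import Literature.MeasureTheory.Hausdorff.SphereHausdorffFinite
import Summits.SmoothPoincare4.SmoothPoincare4.Theorems.CylinderEntropySliceCalibrationGegenbauer
import HarnessLib

/-!
# Stub `stub_funkHeckeVanishing` (K1): zonal Gegenbauer polynomials of positive degree integrate to
# zero over the round `S⁴`

Stub `stub_funkHeckeVanishing` of line `ball-mass-slack` of the crux `CylinderEntropy.ThinCrossSectionExists`
(`stmt-SmoothPoincare4-7633`), proved with its registered statement verbatim: for `k ≥ 1` and a unit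
vector `u ∈ ℝ⁵`, `∫_{S⁴} C_k^{(3/2)}(⟨x, u⟩) dμHE⁴(x) = 0` (the order-`0` Funk–Hecke formula; `gegen k`
is the typed finite sum DLMF 18.5.10, identified with `C_k^{(3/2)} ∈ ℝ[X]` by the landed
`CylinderEntropySliceCalibration.gegen_eq_eval_gp`).

Proof (no coarea, no one-dimensional reduction).  The tree's Killing-field identity
`Literature.MeasureTheory.Hausdorff.integral_sphere_fderiv_rotation_eq_zero`
(`∫_{S_r} DF(x)[⟨u,x⟩ v - ⟨v,x⟩ u] dμHE^k = 0` for `C¹` `F` and orthonormal `u ⊥ v`) applied to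
`F(x) = ⟨v,x⟩ p'(⟨u,x⟩)` (`p ∈ ℝ[X]`) gives `∫ [⟨u,x⟩ p'(⟨u,x⟩) - ⟨v,x⟩² p''(⟨u,x⟩)] = 0`
(`integral_sphere_inner_mul_polynomial_eq`); summing over an orthonormal basis of `uᗮ`
(`Σ_j ⟨v_j,x⟩² = r² - ⟨u,x⟩²` on `S_r`) yields
`∫ [k ⟨u,x⟩ p'(⟨u,x⟩) - (r² - ⟨u,x⟩²) p''(⟨u,x⟩)] = 0` (`integral_sphere_ultraspherical_eq_zero`),
exactly as in the tree's `integral_sphere_exp_inner_mul_inner` (which does this for `exp`).  For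
`V = ℝ⁵`, `k = 4`, `r = 1`, `p = C_k^{(3/2)}` the landed ultraspherical ODE
`CylinderEntropySliceCalibration.eval_gp_ode` (`(1 - s²) C_k'' - 4 s C_k' = -k(k+3) C_k`) turns the
integrand into `k(k+3) C_k(⟨u,x⟩)`, and `k(k+3) ≠ 0`.

Everything here is proved; no facts and no `Prop`-valued definitions are introduced.
-/

noncomputable section

set_option linter.dupNamespace false

open scoped MeasureTheory ENNReal BigOperators RealInnerProductSpace
open Set Metric Module Submodule Polynomial MeasureTheory MeasureTheory.Measure
open Literature.Geometry.Riemannian.SphericalCylinderEntropy (gegen)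
open Literature.Analysis.SpecialFunctions (gegenbauerHom)
open Literature.MeasureTheory.Hausdorff (integral_sphere_fderiv_rotation_eq_zero
  euclideanHausdorffMeasure_sphere_lt_top inner_pole_eq_zero
  norm_sq_orthogonalProjectionOnto_orthogonal_singleton)
open Summit.SmoothPoincare4.SmoothPoincare4.Theorems.CylinderEntropySliceCalibration (gegen_eq_eval_gp
  eval_gp_ode)

namespace Summit.SmoothPoincare4.SmoothPoincare4.Theorems.ThinCrossSectionExists.BallMassSlack

variable {V : Type*} [NormedAddCommGroup V] [InnerProductSpace ℝ V] [FiniteDimensional ℝ V]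
  [MeasurableSpace V] [BorelSpace V]

/-- The Killing identity for `F(x) = ⟪v,x⟫ p'(⟪u,x⟫)` with `p ∈ ℝ[X]` and an orthonormal pair
`u ⊥ v` in a `(k+1)`-dimensional real inner product space:
`∫_{S_r} (⟪u,x⟫ p'(⟪u,x⟫) - ⟪v,x⟫² p''(⟪u,x⟫)) dμHE[k] = 0`. [folklore] -/
theorem integral_sphere_inner_mul_polynomial_eq {k : ℕ} (hV : finrank ℝ V = k + 1) {u v : V}
    (hu : ‖u‖ = 1) (hv : ‖v‖ = 1) (huv : ⟪u, v⟫ = 0) (r : ℝ) (p : ℝ[X]) :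
    ∫ x in sphere (0 : V) r, (⟪u, x⟫ * (derivative p).eval ⟪u, x⟫ -
        ⟪v, x⟫ ^ 2 * (derivative (derivative p)).eval ⟪u, x⟫) ∂(μHE[k] : Measure V) = 0 := by
  have hvv : ⟪v, v⟫ = 1 := by rw [real_inner_self_eq_norm_sq, hv, one_pow]
  have hvu : ⟪v, u⟫ = 0 := by rw [real_inner_comm, huv]
  have huu : ⟪u, u⟫ = 1 := by rw [real_inner_self_eq_norm_sq, hu, one_pow]
  -- `F(x) = ⟪v,x⟫ p'(⟪u,x⟫)` and its derivative
  set F : V → ℝ := fun x ↦ ⟪v, x⟫ * (derivative p).eval ⟪u, x⟫ with hF_def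
  have hpoly : ContDiff ℝ 1 (fun s : ℝ ↦ (derivative p).eval s) := by
    simpa only [coe_aeval_eq_eval] using (derivative p).contDiff_aeval (𝕜 := ℝ) 1
  have hF : ContDiff ℝ 1 F :=
    (contDiff_const.inner ℝ contDiff_id).mul (hpoly.comp (contDiff_const.inner ℝ contDiff_id))
  have hderiv : ∀ x, HasFDerivAt F
      (⟪v, x⟫ • ((derivative (derivative p)).eval ⟪u, x⟫ • innerSL ℝ u) +
        (derivative p).eval ⟪u, x⟫ • innerSL ℝ v) x := by
    intro x
    have h1 : HasFDerivAt (fun x : V ↦ ⟪v, x⟫) (innerSL ℝ v) x := (innerSL ℝ v).hasFDerivAt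
    have h2 : HasFDerivAt (fun x : V ↦ ⟪u, x⟫) (innerSL ℝ u) x := (innerSL ℝ u).hasFDerivAt
    have h3 : HasDerivAt (fun s : ℝ ↦ (derivative p).eval s)
        ((derivative (derivative p)).eval ⟪u, x⟫) ⟪u, x⟫ := (derivative p).hasDerivAt _
    have h4 := h3.comp_hasFDerivAt x h2
    exact h1.mul h4
  have hval : ∀ x, fderiv ℝ F x (⟪u, x⟫ • v - ⟪v, x⟫ • u) =
      ⟪u, x⟫ * (derivative p).eval ⟪u, x⟫ -
        ⟪v, x⟫ ^ 2 * (derivative (derivative p)).eval ⟪u, x⟫ := by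
    intro x
    rw [(hderiv x).fderiv]
    simp only [_root_.add_apply, _root_.smul_apply, innerSL_apply_apply, inner_sub_right, inner_smul_right, huu,
      hvv, huv, hvu, smul_eq_mul]
    ring
  have h0 := integral_sphere_fderiv_rotation_eq_zero hV hu hv huv r hF
  simp_rw [hval] at h0
  exact h0

/-- **The summed Killing identity** (the ultraspherical operator is a divergence on round spheres):
for a unit vector `u` in a `(k+1)`-dimensional real inner product space, a radius `r` and `p ∈ ℝ[X]`,
`∫_{S_r} (k ⟪u,x⟫ p'(⟪u,x⟫) - (r² - ⟪u,x⟫²) p''(⟪u,x⟫)) dμHE[k] = 0` (sum of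
`integral_sphere_inner_mul_polynomial_eq` over an orthonormal basis of `uᗮ`, using
`Σ_j ⟪v_j,x⟫² = ‖x‖² - ⟪u,x⟫²`). [folklore] -/
theorem integral_sphere_ultraspherical_eq_zero {k : ℕ} (hV : finrank ℝ V = k + 1) {u : V}
    (hu : ‖u‖ = 1) (r : ℝ) (p : ℝ[X]) :
    ∫ x in sphere (0 : V) r, ((k : ℝ) * (⟪u, x⟫ * (derivative p).eval ⟪u, x⟫) -
        (r ^ 2 - ⟪u, x⟫ ^ 2) * (derivative (derivative p)).eval ⟪u, x⟫) ∂(μHE[k] : Measure V) =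
      0 := by
  haveI : Fact (finrank ℝ V = k + 1) := ⟨hV⟩
  have hu0 : u ≠ 0 := fun h ↦ by simp [h] at hu
  set K : Submodule ℝ V := (ℝ ∙ u)ᗮ with hK_def
  have hK : finrank ℝ K = k := finrank_orthogonal_span_singleton hu0
  set b : OrthonormalBasis (Fin k) ℝ K := (stdOrthonormalBasis ℝ K).reindex (finCongr hK) with hb_def
  -- each basis vector gives one Killing identity
  have hj : ∀ j : Fin k,
      ∫ x in sphere (0 : V) r, (⟪u, x⟫ * (derivative p).eval ⟪u, x⟫ -
        ⟪(b j : V), x⟫ ^ 2 * (derivative (derivative p)).eval ⟪u, x⟫) ∂(μHE[k] : Measure V) = 0 := by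
    intro j
    have hv : ‖(b j : V)‖ = 1 := by rw [Submodule.norm_coe]; exact b.orthonormal.1 j
    have huv : ⟪u, (b j : V)⟫ = 0 := inner_pole_eq_zero (b j)
    exact integral_sphere_inner_mul_polynomial_eq hV hu hv huv r p
  -- Parseval in `uᗮ`: `Σ_j ⟪b j, x⟫² = ‖x‖² - ⟪u,x⟫²`
  have hparseval : ∀ x : V, ∑ j, ⟪(b j : V), x⟫ ^ 2 = ‖x‖ ^ 2 - ⟪u, x⟫ ^ 2 := by
    intro x
    rw [← norm_sq_orthogonalProjectionOnto_orthogonal_singleton hu x, ← b.sum_sq_inner_right]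
    refine Finset.sum_congr rfl fun j _ ↦ ?_
    rw [inner_orthogonalProjectionOnto_eq_of_mem_left]
  -- integrability of continuous functions on the sphere
  have hfin : (μHE[k] : Measure V) (sphere (0 : V) r) < ⊤ := euclideanHausdorffMeasure_sphere_lt_top hV r
  have hint : ∀ {G : V → ℝ}, Continuous G → IntegrableOn G (sphere (0 : V) r) (μHE[k] : Measure V) := by
    intro G hG
    obtain ⟨M, hM⟩ := (isCompact_sphere (0 : V) r).exists_bound_of_continuousOn hG.continuousOn
    exact Measure.integrableOn_of_bounded (M := M) hfin.ne hG.aestronglyMeasurable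
      ((ae_restrict_iff' isClosed_sphere.measurableSet).2 (ae_of_all _ fun x hx ↦ hM x hx))
  have hpc : ∀ q : ℝ[X], Continuous fun s : ℝ ↦ q.eval s := fun q ↦ q.continuous
  have hi : ∀ j : Fin k, IntegrableOn (fun x : V ↦ ⟪u, x⟫ * (derivative p).eval ⟪u, x⟫ -
      ⟪(b j : V), x⟫ ^ 2 * (derivative (derivative p)).eval ⟪u, x⟫) (sphere (0 : V) r)
      (μHE[k] : Measure V) := by
    intro j
    refine hint ?_
    have h1 : Continuous fun x : V ↦ (derivative p).eval ⟪u, x⟫ :=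
      (hpc _).comp (continuous_const.inner continuous_id)
    have h2 : Continuous fun x : V ↦ (derivative (derivative p)).eval ⟪u, x⟫ :=
      (hpc _).comp (continuous_const.inner continuous_id)
    fun_prop
  -- sum the identities
  have hsum : ∫ x in sphere (0 : V) r, ∑ j : Fin k, (⟪u, x⟫ * (derivative p).eval ⟪u, x⟫ -
      ⟪(b j : V), x⟫ ^ 2 * (derivative (derivative p)).eval ⟪u, x⟫) ∂(μHE[k] : Measure V) = 0 := by
    rw [integral_finsetSum _ fun j _ ↦ hi j]
    exact Finset.sum_eq_zero fun j _ ↦ hj j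
  refine Eq.trans (setIntegral_congr_fun isClosed_sphere.measurableSet fun x hx ↦ ?_) hsum
  simp only [Finset.sum_sub_distrib, Finset.sum_const, Finset.card_univ, Fintype.card_fin,
    nsmul_eq_mul, ← Finset.sum_mul]
  rw [hparseval x, mem_sphere_zero_iff_norm.1 hx]

/-- **Stub K1** (`stub_funkHeckeVanishing`): for `k ≥ 1` and a unit vector `u ∈ ℝ⁵`, the zonal
Gegenbauer polynomial `x ↦ C_k^{(3/2)}(⟨x, u⟩)` integrates to zero over the round unit sphere
`S⁴ ⊂ ℝ⁵` with respect to `μHE⁴` (Funk–Hecke at order `0`): the summed Killing identity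
`integral_sphere_ultraspherical_eq_zero` for `p = C_k^{(3/2)}`, `r = 1`, combined with the
ultraspherical ODE `(1 - s²) C_k'' - 4 s C_k' = -k(k+3) C_k` (`eval_gp_ode`), gives
`k(k+3) ∫_{S⁴} C_k^{(3/2)}(⟨x,u⟩) = 0`. [folklore] -/
theorem stub_funkHeckeVanishing :
    ∀ k : ℕ, 1 ≤ k → ∀ u : EuclideanSpace ℝ (Fin 5), ∑ i : Fin 5, u i ^ 2 = 1 →
      ∫ x in Metric.sphere (0 : EuclideanSpace ℝ (Fin 5)) 1, gegen k (∑ i : Fin 5, x i * u i) ∂μHE[4] = 0 := by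
  intro k hk u hu
  have hV : finrank ℝ (EuclideanSpace ℝ (Fin 5)) = 4 + 1 := finrank_euclideanSpace_fin
  have hu1 : ‖u‖ = 1 := by
    have h := EuclideanSpace.real_norm_sq_eq u
    rw [hu] at h
    exact (pow_eq_one_iff_of_nonneg (norm_nonneg u) two_ne_zero).1 h
  have hinner : ∀ x : EuclideanSpace ℝ (Fin 5), ⟪u, x⟫ = ∑ i : Fin 5, x i * u i := fun x ↦ by
    simp only [PiLp.inner_apply, RCLike.inner_apply, conj_trivial]
  set P : ℝ[X] := gegenbauerHom (3 / 2 : ℝ) k ((2 : ℝ[X]) * X) 1 with hP_def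
  have h0 := integral_sphere_ultraspherical_eq_zero hV hu1 1 P
  -- the integrand is `k(k+3) C_k(⟪u,x⟫)` by the ultraspherical ODE
  have h1 : ∫ x in sphere (0 : EuclideanSpace ℝ (Fin 5)) 1,
      ((k : ℝ) * ((k : ℝ) + 3)) * P.eval ⟪u, x⟫ ∂μHE[4] = 0 := by
    refine Eq.trans (setIntegral_congr_fun isClosed_sphere.measurableSet fun x _ ↦ ?_) h0
    have hode := eval_gp_ode k ⟪u, x⟫
    rw [← hP_def] at hode
    push_cast
    linear_combination hode
  rw [integral_const_mul, mul_eq_zero] at h1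
  have hne : (k : ℝ) * ((k : ℝ) + 3) ≠ 0 := by
    have hk' : (1 : ℝ) ≤ k := by exact_mod_cast hk
    positivity
  have h2 := h1.resolve_left hne
  refine Eq.trans (setIntegral_congr_fun isClosed_sphere.measurableSet fun x _ ↦ ?_) h2
  simp only
  rw [gegen_eq_eval_gp, ← hinner]

end Summit.SmoothPoincare4.SmoothPoincare4.Theorems.ThinCrossSectionExists.BallMassSlack

end
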